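import Summits.SmoothPoincare4.SmoothPoincare4.Theorems.CylinderEntropySliceIsolationStubSeparationPersistsAux2
import Summits.SmoothPoincare4.SmoothPoincare4.Theorems.CylinderEntropyCylinderRungTwoKillingFluxDefs
import HarnessLib

/-!
# End-separation persists along a cylinder flow, part 5: families — the joint chart representative, limits of normals

Part of the proof of the stub `stub_separationPersists` (END-SEPARATION PERSISTS ALONG A CYLINDER
FLOW) of line `conformal-kernel-domination` (closing chain γ) of the crux `CylinderEntropy.SliceIsolation`
(stmt-SmoothPoincare4-7632); see `CylinderEntropySliceIsolationStubSeparationPersists.lean` for the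
overall argument. Everything here is proved (no named facts).

Along a cylinder flow `IsCylinderMCF M F ν T` (vocabulary of crux 7631,
`Theorems/CylinderEntropyCylinderRungTwoKillingFluxDefs.lean`):

* `contDiffAt_jointChartRep`, `fderiv_jointChartRep_comp_inr` — the JOINT chart representative
  `(s, a) ↦ F s (φ⁻¹ a)` is `C^∞`, with space partial the differential of the slice chart
  representative;
* `cylFlow_abs_inner_eq_one_of_tendsto` — **limits of unit normals are unit normals**: if `sₙ → t`,
  `xₙ → x₀`, `κₙ = ± ν(sₙ, xₙ) → κ₀` then `|⟪κ₀, ν(t, x₀)⟫| = 1` (part 2: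
  `abs_inner_nu_eq_one_of_normal`); hence `cylFlow_exists_abs_inner_nu_gt` — the normal at a point
  converges up to sign;
* `cylFlow_uniform_close` — nearby slices are uniformly close (no continuity of `ν` in time is
  used anywhere: its global sign may flip with `t`).

## References

* M. W. Hirsch, *Differential Topology*, GTM 33 (1976), Ch. 4 §5 (tubular neighbourhoods), Ch. 8
  Thm. 1.3 (isotopy extension). [HirschDT1976]
* A. Hatcher, *Algebraic Topology*, CUP (2002), Prop. 3.46 (Jordan–Brouwer separation via Alexander
  duality). [HatcherAT2002]
-/

set_option linter.dupNamespace false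

noncomputable section

open MeasureTheory Set Function Filter Module Asymptotics Metric
open scoped Manifold ContDiff ENNReal Topology RealInnerProductSpace NNReal

namespace Summit.SmoothPoincare4.SmoothPoincare4.Theorems.CylinderEntropySliceIsolation

open Summit.SmoothPoincare4.SmoothPoincare4.Theorems.CylinderRungTwo.KillingFlux
open Literature.Geometry.Riemannian
open Literature.Geometry.Lorentzian Literature.Geometry.Lorentzian.PseudoRiemannianMetric
open Literature.Geometry.Riemannian.SphericalCylinderEntropy (truncL truncL_apply lipschitz_truncL)
open Literature.Geometry.Manifold.CylinderSlice (axis castSucc_ne_five padL padL_apply_castSucc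
  padL_apply_last)

/-! ## Part 3: families — joint chart representatives, limits of normals, uniform push-offs -/

section Family

open Summit.SmoothPoincare4.SmoothPoincare4.Cruxes.CylinderRungTwo.KillingFlux (IsCylinderMCF)


variable {M : Type} [TopologicalSpace M] [ChartedSpace (EuclideanSpace ℝ (Fin 4)) M]
  [IsManifold (𝓡 4) ∞ M]

variable {F : ℝ → M → EuclideanSpace ℝ (Fin 6)} {U : Set ℝ}

omit [IsManifold (𝓡 4) ∞ M] in
/-- Space slices of a jointly smooth family are smooth. [folklore] -/
-- adapted from `contMDiff_slice_of_contMDiffOn`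
-- (Theorems/CylinderEntropyCylinderRungTwoAreaDissipationMetric.lean)
theorem contMDiff_slice
    (hF : ContMDiffOn (𝓘(ℝ, ℝ).prod (𝓡 4)) (𝓡 6) ∞ (fun p : ℝ × M => F p.1 p.2) (U ×ˢ univ))
    {t : ℝ} (ht : t ∈ U) : ContMDiff (𝓡 4) (𝓡 6) ∞ (F t) :=
  hF.comp_contMDiff (f := fun y : M => (t, y)) (contMDiff_const.prodMk contMDiff_id)
    fun _ => ⟨ht, mem_univ _⟩

omit [IsManifold (𝓡 4) ∞ M] in
/-- A jointly smooth family is jointly continuous at interior times. [folklore] -/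
theorem continuousAt_family (hU : IsOpen U)
    (hF : ContMDiffOn (𝓘(ℝ, ℝ).prod (𝓡 4)) (𝓡 6) ∞ (fun p : ℝ × M => F p.1 p.2) (U ×ˢ univ))
    {t : ℝ} (ht : t ∈ U) (x : M) : ContinuousAt (fun p : ℝ × M => F p.1 p.2) (t, x) :=
  hF.continuousOn.continuousAt ((hU.prod isOpen_univ).mem_nhds ⟨ht, mem_univ _⟩)

/-- **The joint chart representative `(s, a) ↦ F s (φ⁻¹ a)` is `C^∞`** at `(s, a)` for `s ∈ U`
and `a` in the chart target. [folklore] -/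
theorem contDiffAt_jointChartRep (hU : IsOpen U)
    (hF : ContMDiffOn (𝓘(ℝ, ℝ).prod (𝓡 4)) (𝓡 6) ∞ (fun p : ℝ × M => F p.1 p.2) (U ×ˢ univ))
    (x₀ : M) {q : ℝ × EuclideanSpace ℝ (Fin 4)} (hq1 : q.1 ∈ U) (hq2 : q.2 ∈ (extChartAt (𝓡 4) x₀).target) :
    ContDiffAt ℝ ∞ (fun q : ℝ × EuclideanSpace ℝ (Fin 4) => F q.1 ((extChartAt (𝓡 4) x₀).symm q.2)) q := by
  have h1 : ContMDiffAt (𝓘(ℝ, ℝ).prod (𝓡 4)) (𝓡 6) ∞ (fun p : ℝ × M => F p.1 p.2)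
      (q.1, (extChartAt (𝓡 4) x₀).symm q.2) :=
    hF.contMDiffAt ((hU.prod isOpen_univ).mem_nhds ⟨hq1, mem_univ _⟩)
  have hfst : ContMDiffAt 𝓘(ℝ, ℝ × EuclideanSpace ℝ (Fin 4)) 𝓘(ℝ, ℝ) ∞
      (Prod.fst : ℝ × EuclideanSpace ℝ (Fin 4) → ℝ) q := contDiff_fst.contMDiff.contMDiffAt
  have hsnd : ContMDiffAt 𝓘(ℝ, ℝ × EuclideanSpace ℝ (Fin 4)) 𝓘(ℝ, EuclideanSpace ℝ (Fin 4)) ∞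
      (Prod.snd : ℝ × EuclideanSpace ℝ (Fin 4) → EuclideanSpace ℝ (Fin 4)) q := contDiff_snd.contMDiff.contMDiffAt
  have hsymm : ContMDiffAt 𝓘(ℝ, ℝ × EuclideanSpace ℝ (Fin 4)) (𝓡 4) ∞
      (fun q : ℝ × EuclideanSpace ℝ (Fin 4) => (extChartAt (𝓡 4) x₀).symm q.2) q :=
    ((contMDiffOn_extChartAt_symm (n := ∞) x₀).contMDiffAt ((isOpen_extChartAt_target x₀).mem_nhds hq2)).comp q hsnd
  have h2 : ContMDiffAt 𝓘(ℝ, ℝ × EuclideanSpace ℝ (Fin 4)) (𝓘(ℝ, ℝ).prod (𝓡 4)) ∞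
      (fun q : ℝ × EuclideanSpace ℝ (Fin 4) => (q.1, (extChartAt (𝓡 4) x₀).symm q.2)) q :=
    hfst.prodMk hsymm
  exact (h1.comp q h2).contDiffAt

/-- **The space partial of the joint chart representative** at `(s, a)` is the differential of the
chart representative of the slice `F s`: `D_a(F ∘ φ⁻¹)(s, a) = d(F s) ∘ D(φ⁻¹)(a)`. [folklore] -/
theorem fderiv_jointChartRep_comp_inr (hU : IsOpen U)
    (hF : ContMDiffOn (𝓘(ℝ, ℝ).prod (𝓡 4)) (𝓡 6) ∞ (fun p : ℝ × M => F p.1 p.2) (U ×ˢ univ))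
    (x₀ : M) {s : ℝ} (hs : s ∈ U) {a : EuclideanSpace ℝ (Fin 4)} (ha : a ∈ (extChartAt (𝓡 4) x₀).target) :
    (fderiv ℝ (fun q : ℝ × EuclideanSpace ℝ (Fin 4) => F q.1 ((extChartAt (𝓡 4) x₀).symm q.2)) (s, a)).comp
        (ContinuousLinearMap.inr ℝ ℝ (EuclideanSpace ℝ (Fin 4))) =
      (((mfderiv (𝓡 4) (𝓡 6) (F s) ((extChartAt (𝓡 4) x₀).symm a)).comp
        (mfderivWithin 𝓘(ℝ, EuclideanSpace ℝ (Fin 4)) (𝓡 4) (extChartAt (𝓡 4) x₀).symm (range (𝓡 4)) a)) :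
          EuclideanSpace ℝ (Fin 4) →L[ℝ] EuclideanSpace ℝ (Fin 6)) := by
  have h𝒢 := ((contDiffAt_jointChartRep hU hF x₀ (q := (s, a)) hs ha).hasStrictFDerivAt (by simp)).hasFDerivAt
  have h1 := HasFDerivAt.comp (f := fun b : EuclideanSpace ℝ (Fin 4) => (s, b)) a h𝒢 (hasFDerivAt_prodMk_right s a)
  have h3 : HasFDerivAt (F s ∘ (extChartAt (𝓡 4) x₀).symm) _ a :=
    hasFDerivAt_comp_extChartAt_symm (contMDiff_slice hF hs) x₀ ha
  exact h1.unique h3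

variable {ν : ℝ → M → EuclideanSpace ℝ (Fin 6)} {T : ℝ}

/-- **Limits of unit normals are unit normals**: along a cylinder flow, if `sₙ → t` (`sₙ ≥ T`),
`xₙ → x₀` and `κₙ = ± ν(sₙ, xₙ) → κ₀`, then `κ₀ = ± ν(t, x₀)`, i.e. `|⟪κ₀, ν(t, x₀)⟫| = 1`
(the tangent spaces `d(F sₙ)_{xₙ}` and the radial normals converge by joint `C¹`-smoothness, and
the unit normal is determined up to sign, `abs_inner_nu_eq_one_of_normal`). [folklore] -/
theorem cylFlow_abs_inner_eq_one_of_tendsto (h : IsCylinderMCF M F ν T) {t : ℝ} (ht : T ≤ t)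
    (x₀ : M) {s : ℕ → ℝ} (hsT : ∀ n, T ≤ s n) (hst : Tendsto s atTop (𝓝 t))
    {x : ℕ → M} (hx : Tendsto x atTop (𝓝 x₀))
    {κ : ℕ → EuclideanSpace ℝ (Fin 6)} (hκ : ∀ n, κ n = ν (s n) (x n) ∨ κ n = -ν (s n) (x n))
    {κ₀ : EuclideanSpace ℝ (Fin 6)} (hκ₀ : Tendsto κ atTop (𝓝 κ₀)) :
    |⟪κ₀, ν t x₀⟫| = 1 := by
  obtain ⟨U, hU, hTU, hF⟩ := h.contMDiffOn
  have htU : t ∈ U := hTU (mem_Ici.2 ht)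
  set φ := extChartAt (𝓡 4) x₀ with hφ
  set a₀ : EuclideanSpace ℝ (Fin 4) := φ x₀ with ha₀
  have hx₀s : x₀ ∈ φ.source := mem_extChartAt_source x₀
  have ha₀t : a₀ ∈ φ.target := φ.map_source hx₀s
  set a : ℕ → EuclideanSpace ℝ (Fin 4) := fun n => φ (x n) with ha
  have halim : Tendsto a atTop (𝓝 a₀) := (continuousAt_extChartAt x₀).tendsto.comp hx
  have hpair : Tendsto (fun n => (s n, a n)) atTop (𝓝 (t, a₀)) := hst.prodMk_nhds halim
  -- the joint chart representative and the continuity of its space partial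
  set 𝒢 : ℝ × EuclideanSpace ℝ (Fin 4) → EuclideanSpace ℝ (Fin 6) := fun q => F q.1 (φ.symm q.2) with h𝒢
  have h𝒢s : ContDiffAt ℝ ∞ 𝒢 (t, a₀) := contDiffAt_jointChartRep hU hF x₀ (q := (t, a₀)) htU ha₀t
  have hDc : ContinuousAt (fun q => (fderiv ℝ 𝒢 q).comp (ContinuousLinearMap.inr ℝ ℝ (EuclideanSpace ℝ (Fin 4))))
      (t, a₀) :=
    (h𝒢s.fderiv_right (m := 0) (by norm_num)).continuousAt.clm_comp continuousAt_const
  -- eventually the identification with the slice differentials holds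
  have e1 : ∀ᶠ n in atTop, x n ∈ φ.source := hx ((isOpen_extChartAt_source x₀).mem_nhds hx₀s)
  have e2 : ∀ᶠ n in atTop, a n ∈ φ.target := halim ((isOpen_extChartAt_target x₀).mem_nhds ha₀t)
  -- orthogonality at the limit, tangential part
  have hκA : ∀ β : EuclideanSpace ℝ (Fin 4),
      ⟪κ₀, fderiv ℝ (fun p : EuclideanSpace ℝ (Fin 4) × ℝ × ℝ =>
      (fun z : EuclideanSpace ℝ (Fin 6) => (‖truncL z‖⁻¹ : ℝ) • (z - z (5 : Fin 6) •
        (axis : EuclideanSpace ℝ (Fin 6))) + z (5 : Fin 6) • (axis : EuclideanSpace ℝ (Fin 6)))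
        (F t ((extChartAt (𝓡 4) x₀).symm p.1) + p.2.1 • ν t ((extChartAt (𝓡 4) x₀).symm p.1)) +
      p.2.2 • ((fun z : EuclideanSpace ℝ (Fin 6) => (‖truncL z‖⁻¹ : ℝ) • (z - z (5 : Fin 6) •
        (axis : EuclideanSpace ℝ (Fin 6))) + z (5 : Fin 6) • (axis : EuclideanSpace ℝ (Fin 6)))
        (F t ((extChartAt (𝓡 4) x₀).symm p.1) + p.2.1 • ν t ((extChartAt (𝓡 4) x₀).symm p.1)) -
        ((fun z : EuclideanSpace ℝ (Fin 6) => (‖truncL z‖⁻¹ : ℝ) • (z - z (5 : Fin 6) •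
        (axis : EuclideanSpace ℝ (Fin 6))) + z (5 : Fin 6) • (axis : EuclideanSpace ℝ (Fin 6)))
        (F t ((extChartAt (𝓡 4) x₀).symm p.1) + p.2.1 • ν t ((extChartAt (𝓡 4) x₀).symm p.1))) (5 : Fin 6) •
          (axis : EuclideanSpace ℝ (Fin 6)))) (extChartAt (𝓡 4) x₀ x₀, 0, 0) (β, 0, 0)⟫ = 0 := by
    intro β
    rw [fderiv_tubeChart_inl (h.isSmoothEmbedding t ht) (h.mem_cyl t ht) (h.contMDiff_normal t ht)
      (h.normal_tangent t ht) x₀ rfl, ← fderiv_jointChartRep_comp_inr hU hF x₀ htU ha₀t]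
    -- the sequence of inner products is identically zero (eventually) and tends to the limit
    have hlim : Tendsto (fun n => ⟪κ n, ((fderiv ℝ 𝒢 (s n, a n)).comp
        (ContinuousLinearMap.inr ℝ ℝ (EuclideanSpace ℝ (Fin 4)))) β⟫) atTop
        (𝓝 ⟪κ₀, ((fderiv ℝ 𝒢 (t, a₀)).comp (ContinuousLinearMap.inr ℝ ℝ (EuclideanSpace ℝ (Fin 4)))) β⟫) := by
      refine hκ₀.inner ?_
      have := (hDc.tendsto.comp hpair)
      exact ((ContinuousLinearMap.apply ℝ (EuclideanSpace ℝ (Fin 6)) β).continuous.tendsto _).comp this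
    have hzero : ∀ᶠ n in atTop, ⟪κ n, ((fderiv ℝ 𝒢 (s n, a n)).comp
        (ContinuousLinearMap.inr ℝ ℝ (EuclideanSpace ℝ (Fin 4)))) β⟫ = 0 := by
      filter_upwards [e1, e2] with n h1 h2
      rw [fderiv_jointChartRep_comp_inr hU hF x₀ (hTU (mem_Ici.2 (hsT n))) h2]
      have hxn : φ.symm (a n) = x n := φ.left_inv h1
      have hνx : ν (s n) (φ.symm (a n)) = ν (s n) (x n) := by rw [hxn]
      have key := inner_nu_mfderiv (h.isUnitNormal (s n) (hsT n)) (φ.symm (a n))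
        ((mfderivWithin 𝓘(ℝ, EuclideanSpace ℝ (Fin 4)) (𝓡 4) φ.symm (range (𝓡 4)) (a n)) β)
      rcases hκ n with hk | hk
      · rw [hk, ← hνx]
        exact key
      · rw [hk, inner_neg_left, neg_eq_zero, ← hνx]
        exact key
    exact tendsto_nhds_unique hlim (tendsto_const_nhds.congr' (hzero.mono fun n hn => hn.symm))
  -- orthogonality at the limit, radial part
  have hFlim : Tendsto (fun n => F (s n) (x n)) atTop (𝓝 (F t x₀)) :=
    (continuousAt_family hU hF htU x₀).tendsto.comp (hst.prodMk_nhds hx)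
  have hκn : ⟪κ₀, F t x₀ - F t x₀ (5 : Fin 6) • (axis : EuclideanSpace ℝ (Fin 6))⟫ = 0 := by
    have h5 : Tendsto (fun n => F (s n) (x n) (5 : Fin 6)) atTop (𝓝 (F t x₀ (5 : Fin 6))) :=
      ((EuclideanSpace.proj (5 : Fin 6)).continuous.tendsto _).comp hFlim
    have hlim : Tendsto (fun n => ⟪κ n, F (s n) (x n) - F (s n) (x n) (5 : Fin 6) • (axis : EuclideanSpace ℝ (Fin 6))⟫)
        atTop (𝓝 ⟪κ₀, F t x₀ - F t x₀ (5 : Fin 6) • (axis : EuclideanSpace ℝ (Fin 6))⟫) :=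
      hκ₀.inner (hFlim.sub (h5.smul_const _))
    have hzero : ∀ n, ⟪κ n, F (s n) (x n) - F (s n) (x n) (5 : Fin 6) • (axis : EuclideanSpace ℝ (Fin 6))⟫ = 0 := by
      intro n
      have key := inner_nu_nrad (ι := F (s n)) (h.normal_tangent (s n) (hsT n)) (x n)
      rcases hκ n with hk | hk
      · rw [hk]; exact key
      · rw [hk, inner_neg_left, neg_eq_zero]; exact key
    exact tendsto_nhds_unique hlim (tendsto_const_nhds.congr' (Eventually.of_forall fun n => (hzero n).symm))
  -- unit length at the limit
  have hκ1 : ‖κ₀‖ = 1 := by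
    have hn : ∀ n, ‖κ n‖ = 1 := fun n => by
      rcases hκ n with hk | hk
      · rw [hk]; exact norm_nu (h.isUnitNormal (s n) (hsT n)) (x n)
      · rw [hk, norm_neg]; exact norm_nu (h.isUnitNormal (s n) (hsT n)) (x n)
    exact tendsto_nhds_unique hκ₀.norm (tendsto_const_nhds.congr' (Eventually.of_forall fun n => (hn n).symm))
  exact abs_inner_nu_eq_one_of_normal (h.isSmoothEmbedding t ht) (h.mem_cyl t ht) (h.contMDiff_normal t ht)
    (h.isUnitNormal t ht) (h.normal_tangent t ht) x₀ rfl hκA hκn hκ1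

end Family

section FamilyPushoff

open Summit.SmoothPoincare4.SmoothPoincare4.Cruxes.CylinderRungTwo.KillingFlux (IsCylinderMCF)

variable {M : Type} [TopologicalSpace M] [ChartedSpace (EuclideanSpace ℝ (Fin 4)) M]
  [IsManifold (𝓡 4) ∞ M]

variable {F : ℝ → M → EuclideanSpace ℝ (Fin 6)} {ν : ℝ → M → EuclideanSpace ℝ (Fin 6)} {T : ℝ}

/-- **Uniform closeness of nearby slices**: for `t ≥ T` and `ε > 0` there is `θ > 0` with
`‖F(s, x) - F(t, x)‖ < ε` for all `x ∈ M` and all times `s ≥ T` with `|s - t| < θ` (joint continuity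
and compactness of `M`). [folklore] -/
theorem cylFlow_uniform_close [T2Space M] [CompactSpace M] (h : IsCylinderMCF M F ν T) {t : ℝ} (ht : T ≤ t)
    {ε : ℝ} (hε : 0 < ε) :
    ∃ θ : ℝ, 0 < θ ∧ ∀ s : ℝ, T ≤ s → |s - t| < θ → ∀ x : M, ‖F s x - F t x‖ < ε := by
  haveI : TopologicalSpace.MetrizableSpace M := Manifold.metrizableSpace (𝓡 4) M
  obtain ⟨U, hU, hTU, hF⟩ := h.contMDiffOn
  have htU : t ∈ U := hTU (mem_Ici.2 ht)
  by_contra H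
  push Not at H
  have hbad : ∀ n : ℕ, ∃ s : ℝ, T ≤ s ∧ |s - t| < 1 / ((n : ℝ) + 1) ∧ ∃ x : M, ε ≤ ‖F s x - F t x‖ :=
    fun n => H _ (by positivity)
  choose s hsT hst x hx using hbad
  obtain ⟨x₀, -, φ, hφ, hxφ⟩ := isCompact_univ.tendsto_subseq (x := x) fun n => mem_univ _
  have h1div : Tendsto (fun n => 1 / ((φ n : ℝ) + 1)) atTop (𝓝 0) :=
    tendsto_one_div_add_atTop_nhds_zero_nat.comp hφ.tendsto_atTop
  have hsφ : Tendsto (fun n => s (φ n)) atTop (𝓝 t) := by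
    rw [tendsto_iff_dist_tendsto_zero]
    refine tendsto_of_tendsto_of_tendsto_of_le_of_le tendsto_const_nhds h1div (fun n => dist_nonneg) fun n => ?_
    rw [Real.dist_eq]; exact (hst (φ n)).le
  have hA : Tendsto (fun n => F (s (φ n)) (x (φ n))) atTop (𝓝 (F t x₀)) :=
    (continuousAt_family hU hF htU x₀).tendsto.comp (hsφ.prodMk_nhds hxφ)
  have hB : Tendsto (fun n => F t (x (φ n))) atTop (𝓝 (F t x₀)) :=
    ((contMDiff_slice hF htU).continuous.tendsto x₀).comp hxφ
  have hlim := (hA.sub hB).norm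
  rw [sub_self, norm_zero] at hlim
  obtain ⟨n, hn⟩ := (hlim.eventually (gt_mem_nhds hε)).exists
  exact absurd (hx (φ n)) (not_le.2 hn)

/-- **The normal at a point converges up to sign**: for every `ε > 0` there is `θ > 0` such that
`1 - ε < |⟪ν(s, x₀), ν(t, x₀)⟫|` for all times `s ≥ T` with `|s - t| < θ` (compactness of the unit
sphere and `limits of unit normals are unit normals`). [folklore] -/
theorem cylFlow_exists_abs_inner_nu_gt [T2Space M] [CompactSpace M] (h : IsCylinderMCF M F ν T)
    {t : ℝ} (ht : T ≤ t) (x₀ : M) {ε : ℝ} (hε : 0 < ε) :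
    ∃ θ : ℝ, 0 < θ ∧ ∀ s : ℝ, T ≤ s → |s - t| < θ → 1 - ε < |⟪ν s x₀, ν t x₀⟫| := by
  by_contra H
  push Not at H
  have hbad : ∀ n : ℕ, ∃ s : ℝ, T ≤ s ∧ |s - t| < 1 / ((n : ℝ) + 1) ∧ |⟪ν s x₀, ν t x₀⟫| ≤ 1 - ε :=
    fun n => H _ (by positivity)
  choose s hsT hst hle using hbad
  have hκ1 : ∀ n, ν (s n) x₀ ∈ Metric.sphere (0 : EuclideanSpace ℝ (Fin 6)) 1 := fun n => by
    rw [mem_sphere_zero_iff_norm]; exact norm_nu (h.isUnitNormal (s n) (hsT n)) x₀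
  obtain ⟨κ₀, -, φ, hφ, hκφ⟩ := (isCompact_sphere (0 : EuclideanSpace ℝ (Fin 6)) 1).tendsto_subseq hκ1
  have h1div : Tendsto (fun n => 1 / ((φ n : ℝ) + 1)) atTop (𝓝 0) :=
    tendsto_one_div_add_atTop_nhds_zero_nat.comp hφ.tendsto_atTop
  have hsφ : Tendsto (fun n => s (φ n)) atTop (𝓝 t) := by
    rw [tendsto_iff_dist_tendsto_zero]
    refine tendsto_of_tendsto_of_tendsto_of_le_of_le tendsto_const_nhds h1div (fun n => dist_nonneg) fun n => ?_
    rw [Real.dist_eq]; exact (hst (φ n)).le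
  have hone := cylFlow_abs_inner_eq_one_of_tendsto h ht x₀ (fun n => hsT (φ n)) hsφ
    (tendsto_const_nhds (x := x₀)) (κ := fun n => ν (s (φ n)) x₀) (fun n => Or.inl rfl) hκφ
  have hlim : Tendsto (fun n => |⟪ν (s (φ n)) x₀, ν t x₀⟫|) atTop (𝓝 (|⟪κ₀, ν t x₀⟫|)) :=
    ((hκφ.inner tendsto_const_nhds).abs)
  rw [hone] at hlim
  have := hlim.eventually (lt_mem_nhds (by linarith : (1 : ℝ) - ε < 1))
  obtain ⟨n, hn⟩ := this.exists
  exact absurd (hle (φ n)) (not_le.2 hn)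

end FamilyPushoff

/-- Marker of this part (registered sub-goal `helper_sepPersistsSlice` of stmt-SmoothPoincare4-7632): space slices of a jointly smooth family are smooth (`contMDiff_slice`). [folklore] -/
theorem helper_sepPersistsSlice :
    ∀ (M : Type) [TopologicalSpace M] [ChartedSpace (EuclideanSpace ℝ (Fin 4)) M] (F : ℝ → M → EuclideanSpace ℝ (Fin 6)) (U : Set ℝ), ContMDiffOn (𝓘(ℝ, ℝ).prod (𝓡 4)) (𝓡 6) ∞ (fun p : ℝ × M => F p.1 p.2) (U ×ˢ Set.univ) → ∀ t ∈ U, ContMDiff (𝓡 4) (𝓡 6) ∞ (F t) :=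
  fun _ _ _ _ _ hF _ ht => contMDiff_slice hF ht

end Summit.SmoothPoincare4.SmoothPoincare4.Theorems.CylinderEntropySliceIsolation
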